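import Mathlib.LinearAlgebra.Matrix.ToLinearEquiv
import Mathlib.LinearAlgebra.Matrix.Nondegenerate
import Mathlib.Analysis.Normed.Group.Constructions
import Mathlib.Topology.MetricSpace.Lipschitz
import Literature.Analysis.ValidatedNumerics.KrawczykOperator
import Literature.Analysis.ValidatedNumerics.KrawczykOperatorHolds
import HarnessLib

/-!
# Verified enclosure of a SIMPLE real eigenpair: Krawczyk's test on the bordered eigen-system

Topic `Literature/Analysis/ValidatedNumerics`.  The standard way self-validating methods PROVE that a real
matrix `A` (or every matrix of an interval family `𝒜 = [A̲, Ā]`) has an eigenpair `(x⋆, λ⋆)` inside a box, that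
the pair is unique there, and that `λ⋆` is a SIMPLE eigenvalue: apply Krawczyk's existence test
(`Literature.Analysis.ValidatedNumerics.KrawczykTest`, Neumaier Thm 5.1.8, PROVED in the tree as
`KrawczykTest_holds`) to the mildly nonlinear ("bordered") system `A x − λ x = 0`, `x_{i₀} = ζ`.
Source typed: G. Alefeld, G. Mayer, *Interval analysis: theory and applications*, J. Comput. Appl. Math.
121 (2000) 421–464 [AlefeldMayer2000], §6 eq. (85)–(88) and **Theorem 18** (p. 449–450; held copy
`lit read paper:doi-10-1016-s0377-0427-00-00342-3`, PDF pages 29–30), a theorem the authors attribute to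
S. M. Rump [Rump1983] ("The following theorem … is due to Rump [81]"), verbatim:

> (85) "`f(x, λ) = ( A x − λ x ; x_{i₀} − ζ ) = 0`, where `i₀` is a fixed index from `{1, …, n}` and `ζ ≠ 0`
> is a constant.  It is obvious that `(x*, λ*)` is a solution of (85) if and only if `(x*, λ*)` is an
> eigenpair of `A` with the normalization `x*_{i₀} = ζ` of the eigenvector `x*`."
> (86) "`f(x, λ) = f(x̃, λ̃) + [[A − λ̃ Iₙ, −x̃], [(e^{(i₀)})ᵀ, 0]] (Δx ; Δλ) − (Δλ Δx ; 0)`"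
> (87) "`(Δx ; Δλ) = g(Δx, Δλ) = −C f(x̃, λ̃) + ( I_{n+1} − C [[A − λ̃ Iₙ, −x̃ − Δx], [(e^{(i₀)})ᵀ, 0]] ) (Δx ; Δλ)`"
> "**Theorem 18.** Let `A ∈ ℝⁿˣⁿ`, `λ̃ ∈ ℝ`, `x̃ ∈ ℝⁿ`, `C ∈ ℝ^{(n+1)×(n+1)}`, and define `g` by (87).  Let `x̃`
> be normalized by `x̃_{i₀} = ζ ≠ 0`.  If `g` fulfills the inclusion  (88) `g([x], [λ]) ⊆ int([x]ᵀ, [λ])ᵀ`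
> then the following assertions hold: (a) `C` is nonsingular.  (b) There exists exactly one eigenvector
> `x* ∈ x̃ + [x]` of `A` which is normalized by `x*_{i₀} = ζ`.  (c) There exists exactly one eigenvalue
> `λ* ∈ λ̃ + [λ]` of `A`.  (d) `A x* = λ* x*` with `x*` from (b) and `λ*` from (c).  (e) The eigenvalue
> `λ*` from (d) is geometric simple.  (f) If `(x̃, λ̃)` is a sufficiently good approximation of the
> eigenpair `(x*, λ*)` from (d) then it can be guaranteed that `λ*` is algebraic simple.  (g) [the iterates
> `([x]^{k+1}, [λ]^{k+1}) = g([x]^k, [λ]^k)` started at `([x], [λ])` are nested and all contain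
> `(x*, λ*) − (x̃, λ̃)`]."
> (p. 451) "In [58] it is shown how (87) can be reduced to an `n`-dimensional problem which, originally,
> formed the starting point in [6]."

## What is typed (the form engine `cap.spectral`, kind `krawczyk-eigpair`, checks), and the two deviations
* REDUCED `n`-DIMENSIONAL UNKNOWNS ([58] = [Mayer1995], [6] = Alefeld 1987), `ζ = 1`: the unknown is
  `z ∈ ℝⁿ` whose slot `k` (= `i₀`) stores `λ` and whose other slots store `x_j`, `j ≠ k`; `x(z) := (z with
  z_k := 1)` (`eigVec`), `G_A(z) := A x(z) − z_k x(z)` (`eigMap`, = the first block of (85)), with Jacobian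
  `J_A(z) = [ (A − z_k I) with column k replaced by −x(z) ]` (`eigJac`, = (86) with the trivial row and
  column of the normalising equation eliminated).  The printed `(x̃, λ̃) + ([x], [λ])` is the box `[l, u] ∋ z̃`.
* HYPOTHESIS IN NEUMAIER'S FORM.  Instead of Rump's operator (87) (slopes with the FIXED `λ̃` in the leading
  block) we require, as interval implementations that evaluate the Jacobian over the whole box do (so does
  `cap.spectral`), an interval matrix `J = [J̲, J̄] ⊇ {J_A(m) : m ∈ [l, u]}` and the inclusion
  `K([l,u], z̃) := z̃ − C G_A(z̃) − (C J − I)([l,u] − z̃) ⊆ int [l, u]` for the Krawczyk operator of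
  `KrawczykOperator.lean` (interval evaluation rendered EXACTLY as the set `krawczykSet`, see that file).
  `J` is then a Lipschitz matrix for `G_A` on the box (`isLipschitzSetOn_eigMap`: for the quadratic map `G_A`
  the slope identity `G_A(z) − G_A(w) = J_A(x-part of z, λ of w)(z − w)` is EXACT — no mean value theorem
  needed; cf. `LipschitzMatrixOfJacobian.lean` for general `C¹` maps), so `KrawczykTest_holds` applies.
  Under this hypothesis every `M ∈ J`, in particular every `J_A(m)`, `m ∈ [l, u]`, is nonsingular, and
  assertion (f) holds UNCONDITIONALLY: `krawczyk_eigenpair` proves (a) [by a vertex / left-null-vector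
  argument, `det_ne_zero_of_krawczykSet_subset_interior`], (b)+(d) [unique zero of `G_A` in the box, lying
  in `K`], (c) in the form "`λ⋆` is the only real eigenvalue of `A` in `[l_k, u_k]`" (any eigenvector,
  any normalisation), (e) `ker(A − λ⋆I) = ℝ x⋆`, and (f) `ker(A − λ⋆I)^{m+1} = ℝ x⋆` for all `m`
  (algebraic simplicity); (c), (e), (f) all come from the kernel identity
  `J_A(m)(u with u_k := c) = (A − m_k I) u − c x(m)` (`u_k = 0`) and the regularity of `J_A(m)`.
* FAMILY FORM (`krawczyk_eigenpair_family`, `…_family'`): for a matrix box `𝒜 = matrixIcc A̲ Ā` the engine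
  evaluates `G` "over the family"; the exact set rendering of that interval evaluation is `krawczykFamSet`
  (row by row an independent choice of `A ∈ 𝒜`, of `B ∈ C·J`, of `y ∈ [l,u]`), which contains
  `krawczykSet … (eigMap A k) …` for each member `A`, so the conclusions hold for EVERY `A ∈ 𝒜`; the
  canonical interval Jacobian — lower bound `eigJacLo A̲ k u`, upper bound `eigJacHi Ā k l` (column `k`:
  `−x(u) … −x(l)`; diagonal `A̲ᵢᵢ − u_k … Āᵢᵢ − l_k`; off-diagonal `A̲ᵢⱼ … Āᵢⱼ`) — is what exact interval
  arithmetic produces for `[[𝒜 − [λ] I]₍:,j≠k₎ | −x([l,u])]`, and it contains every `J_A(m)`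
  (`eigJac_mem_matrixIcc`).  Outward rounding only ENLARGES `J` and `K`; the
  theorem is stated for an arbitrary `J ⊇` the Jacobians, and `K ⊆ int` is monotone, so a machine check
  with rounded quantities implies the typed hypotheses.
* DICTIONARY to `cap.spectral.krawczyk` (which orders the unknowns as `(x_j)_{j≠k}` increasing, then `λ`
  LAST): the coordinate permutation `π` with `π(k) = last`, `π(j) = rank of j among {j ≠ k}` carries our
  `z, [l,u], K, J` to the engine's `z, Z, K, J(Z)` (conjugating `C` and `J`); `K ⊆ int Z` and entrywise
  interval membership are invariant under it.  The engine's `𝒜 = {A : |A − A_c| ≤ Δ}` is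
  `matrixIcc (A_c − Δ) (A_c + Δ)`.
* NOT typed: assertion (g) (nested convergence of the iteration (89)), Theorem 19 (the a-priori radii
  `β±`), Rump's fixed-`λ̃` slope form (87) itself, complex eigenpairs of real matrices, clusters / invariant
  subspaces [Rump2010Verification, §13.4].

## Mathlib / tree search
`lean search --decl 'eigenpair|Krawczyk.*eigen'`: no verified eigenpair-enclosure theorem in Mathlib or the
tree (the tree has the symmetric/Hermitian spectral enclosures `MatrixEigenEnclosure.lean`,
`EigenvalueNearCertificate.lean`, the Krawczyk operator `KrawczykOperator(Holds).lean`, the linear-system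
layer `IntervalLinearSystems.lean` and `LipschitzMatrixOfJacobian.lean`; nothing for NON-symmetric
eigenpairs).  Mathlib supplies `Matrix.exists_vecMul_eq_zero_iff` / `Matrix.eq_zero_of_mulVec_eq_zero`
(kernel vs determinant) used here.

## References
* [AlefeldMayer2000] G. Alefeld, G. Mayer, J. Comput. Appl. Math. 121 (2000) 421–464,
  doi:10.1016/s0377-0427(00)00342-3, §6 (85)–(88), Theorem 18.
* [Rump1983] S. M. Rump, Solving algebraic problems with high accuracy, in: U. Kulisch, W. Miranker (eds.),
  A New Approach to Scientific Computation, Academic Press 1983, 51–120, doi:10.1016/b978-0-12-428660-3.50010-0.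
* [Mayer1995] G. Mayer, Epsilon-inflation in verification algorithms, J. Comput. Appl. Math. 60 (1995)
  147–169 (the `n`-dimensional reduction).
* [Neumaier1991] A. Neumaier, Interval Methods for Systems of Equations, CUP 1990, §5.1 (6), Thm 5.1.8.
* [Krawczyk1969] R. Krawczyk, Computing 4 (1969) 187–201.
* [Rump2010Verification] S. M. Rump, Acta Numerica 19 (2010) 287–449, §13.4 (not held, acq-08455).

AI-produced formalisation (H21 engines seat eng-cap-2, 2026-08-21).
-/

set_option autoImplicit false

noncomputable section

open Set Matrix

namespace Literature.Analysis.ValidatedNumerics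

variable {n : ℕ}

/-! ## The bordered eigen-system with the normalisation `x_k = 1` -/

/-- `x(z)`: the vector with `x_k = 1` and `x_j = z_j` for `j ≠ k` (the unknown `z` stores `λ` in slot `k`).
[cite: AlefeldMayer2000, §6 eq. (85) (normalisation `x_{i₀} = ζ`, here `ζ = 1`)] -/
def eigVec (k : Fin n) (z : Fin n → ℝ) : Fin n → ℝ := Function.update z k 1

/-- `G_A(z) := A x(z) − λ x(z)` with `λ := z k`: the bordered eigen-map whose zeros are the eigenpairs of `A`
normalised by `x_k = 1`. [cite: AlefeldMayer2000, §6 eq. (85)] -/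
def eigMap (A : Matrix (Fin n) (Fin n) ℝ) (k : Fin n) (z : Fin n → ℝ) : Fin n → ℝ :=
  A *ᵥ eigVec k z - z k • eigVec k z

/-- The Jacobian `J_A(z)` of `G_A` at `z`: column `j ≠ k` is column `j` of `A − λ I`, column `k` is `−x(z)`.
[cite: AlefeldMayer2000, §6 eq. (86)] -/
def eigJac (A : Matrix (Fin n) (Fin n) ℝ) (k : Fin n) (z : Fin n → ℝ) : Matrix (Fin n) (Fin n) ℝ :=
  Matrix.of fun i j => if j = k then -eigVec k z i else A i j - if i = j then z k else 0

/-- The normalising entry: `x(z)_k = 1` (`= ζ`). [cite: AlefeldMayer2000, §6 eq. (85) (normalisation)] -/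
@[simp] theorem eigVec_apply_self (k : Fin n) (z : Fin n → ℝ) : eigVec k z k = 1 := by
  simp [eigVec]

/-- The free entries: `x(z)_j = z_j` for `j ≠ k`. [cite: AlefeldMayer2000, §6 eq. (85) (normalisation)] -/
theorem eigVec_apply_of_ne {k j : Fin n} (h : j ≠ k) (z : Fin n → ℝ) : eigVec k z j = z j := by
  simp [eigVec, h]

/-- `x(z)` does not depend on the `λ`-slot `z_k`. [cite: AlefeldMayer2000, §6 eq. (85) (normalisation)] -/
@[simp] theorem eigVec_update (k : Fin n) (z : Fin n → ℝ) (c : ℝ) :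
    eigVec k (Function.update z k c) = eigVec k z := by
  simp [eigVec]

/-- `x(z) ≠ 0` (its `k`-th entry is `1 = ζ ≠ 0`). [cite: AlefeldMayer2000, §6 eq. (85) (`ζ ≠ 0`)] -/
theorem eigVec_ne_zero (k : Fin n) (z : Fin n → ℝ) : eigVec k z ≠ 0 := fun h => by
  simpa using congr_fun h k

/-- Action of the Jacobian (86) in the reduced unknowns:
`J_A(m) v = (A − λ_m I)(v with v_k := 0) − v_k x(m)`. [cite: AlefeldMayer2000, §6 eq. (86)] -/
theorem eigJac_mulVec (A : Matrix (Fin n) (Fin n) ℝ) (k : Fin n) (m v : Fin n → ℝ) :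
    eigJac A k m *ᵥ v =
      (A - m k • (1 : Matrix (Fin n) (Fin n) ℝ)) *ᵥ Function.update v k 0 - v k • eigVec k m := by
  ext i
  have h1 : ∀ j, eigJac A k m i j * v j =
      (A - m k • (1 : Matrix (Fin n) (Fin n) ℝ)) i j * Function.update v k 0 j
        + (if j = k then -(eigVec k m i) * v k else 0) := by
    intro j
    by_cases hj : j = k
    · rw [hj]
      simp [eigJac]
    · rcases eq_or_ne i j with rfl | hij
      · simp [eigJac, hj]
      · simp [eigJac, hj, hij]
  simp only [mulVec, dotProduct, Pi.sub_apply, Pi.smul_apply, smul_eq_mul]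
  rw [Finset.sum_congr rfl fun j _ => h1 j, Finset.sum_add_distrib]
  simp only [Finset.sum_ite_eq', Finset.mem_univ, if_true]
  ring

/-- The **exact slope identity** of the (quadratic) bordered map: for all `z, w`,
`G_A(z) − G_A(w) = J_A(m)(z − w)` with the mixed point `m := (x-part of z, λ of w)` — the exact Taylor
expansion (86) with its quadratic remainder `−(Δλ Δx ; 0)` absorbed into the mixed-point Jacobian.  Hence on
a BOX the Jacobian range is a Lipschitz set in Neumaier's sense. [cite: AlefeldMayer2000, §6 eq. (86)] -/
theorem eigMap_sub_eigMap (A : Matrix (Fin n) (Fin n) ℝ) (k : Fin n) (z w : Fin n → ℝ) :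
    eigMap A k z - eigMap A k w = eigJac A k (Function.update z k (w k)) *ᵥ (z - w) := by
  rw [eigJac_mulVec]
  have hx : Function.update (z - w) k 0 = eigVec k z - eigVec k w := by
    ext j
    by_cases hj : j = k
    · rw [hj]; simp
    · simp [hj, eigVec_apply_of_ne hj]
  rw [hx, Function.update_self, eigVec_update]
  simp only [eigMap, sub_mulVec, mulVec_sub, Matrix.smul_mulVec, one_mulVec]
  ext i
  simp only [Pi.sub_apply, Pi.smul_apply, smul_eq_mul]
  ring

/-- On a box `[l, u]`, any set of matrices containing every Jacobian `J_A(m)`, `m ∈ [l, u]`, is a Lipschitz set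
for `G_A` (Neumaier §5.1 (6)). [cite: Neumaier1991, §5.1 eq. (6); Cor. 5.1.5] -/
theorem isLipschitzSetOn_eigMap {A : Matrix (Fin n) (Fin n) ℝ} {k : Fin n}
    {J : Set (Matrix (Fin n) (Fin n) ℝ)} {l u : Fin n → ℝ} (hJ : ∀ m ∈ Icc l u, eigJac A k m ∈ J) :
    IsLipschitzSetOn J (eigMap A k) (Icc l u) := by
  intro z hz w hw
  refine ⟨eigJac A k (Function.update z k (w k)), hJ _ ?_, eigMap_sub_eigMap A k z w⟩
  rw [mem_Icc] at hz hw ⊢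
  exact ⟨le_update_iff.2 ⟨hw.1 k, fun j _ => hz.1 j⟩, update_le_iff.2 ⟨hw.2 k, fun j _ => hz.2 j⟩⟩

/-- A map admitting an interval Lipschitz matrix `[A̲, Ā]` on `D` is Lipschitz continuous on `D`
("Conversely, if `A` is a Lipschitz set for `F` on `D` then `F` is Lipschitz continuous on `D`"; here in the
sup norm with the crude constant `Σᵢⱼ (|A̲ᵢⱼ| + |Āᵢⱼ|)`), so the first hypothesis of `KrawczykTest` follows
from the second. [cite: Neumaier1991, §5.1 (remark preceding Thm 5.1.6)] -/
theorem exists_lipschitzOnWith_of_isLipschitzSetOn {Al Au : Matrix (Fin n) (Fin n) ℝ}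
    {F : (Fin n → ℝ) → (Fin n → ℝ)} {D : Set (Fin n → ℝ)} (h : IsLipschitzSetOn (matrixIcc Al Au) F D) :
    ∃ K, LipschitzOnWith K F D := by
  have hN0 : 0 ≤ ∑ i, ∑ j, (|Al i j| + |Au i j|) :=
    Finset.sum_nonneg fun i _ => Finset.sum_nonneg fun j _ => add_nonneg (abs_nonneg _) (abs_nonneg _)
  refine ⟨Real.toNNReal (∑ i, ∑ j, (|Al i j| + |Au i j|)), LipschitzOnWith.of_dist_le_mul fun x hx y hy => ?_⟩
  obtain ⟨M, hM, hxy⟩ := h x hx y hy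
  rw [dist_eq_norm, hxy, Real.coe_toNNReal _ hN0, dist_eq_norm]
  refine (pi_norm_le_iff_of_nonneg (mul_nonneg hN0 (norm_nonneg _))).2 fun i => ?_
  rw [Real.norm_eq_abs]
  have hrow : ∀ j, |M i j| ≤ |Al i j| + |Au i j| := fun j =>
    (abs_le_max_abs_abs (hM i j).1 (hM i j).2).trans (max_le_add_of_nonneg (abs_nonneg _) (abs_nonneg _))
  calc |(M *ᵥ (x - y)) i| = |∑ j, M i j * (x - y) j| := rfl
    _ ≤ ∑ j, |M i j * (x - y) j| := Finset.abs_sum_le_sum_abs _ _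
    _ ≤ ∑ j, |M i j| * ‖x - y‖ := Finset.sum_le_sum fun j _ => by
          rw [abs_mul]
          exact mul_le_mul_of_nonneg_left
            (by simpa only [Real.norm_eq_abs] using norm_le_pi_norm (x - y) j) (abs_nonneg _)
    _ ≤ (∑ j, (|Al i j| + |Au i j|)) * ‖x - y‖ := by
        rw [← Finset.sum_mul]
        exact mul_le_mul_of_nonneg_right (Finset.sum_le_sum fun j _ => hrow j) (norm_nonneg _)
    _ ≤ (∑ i, ∑ j, (|Al i j| + |Au i j|)) * ‖x - y‖ := by
        refine mul_le_mul_of_nonneg_right ?_ (norm_nonneg _)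
        exact Finset.single_le_sum (f := fun i => ∑ j, (|Al i j| + |Au i j|))
          (fun i _ => Finset.sum_nonneg fun j _ => add_nonneg (abs_nonneg _) (abs_nonneg _))
          (Finset.mem_univ i)

/-- Membership in the interior of a box is strict componentwise inequality. [folklore] -/
private theorem mem_interior_Icc_iff' {l u y : Fin n → ℝ} :
    y ∈ interior (Icc l u) ↔ ∀ i, l i < y i ∧ y i < u i := by
  rw [← Set.pi_univ_Icc, interior_pi_set Set.finite_univ]
  simp only [interior_Icc, Set.mem_univ_pi, Set.mem_Ioo]

/-- **The preconditioner is nonsingular** (Alefeld–Mayer Thm 18 (a)): if the set-rendered Krawczyk image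
`K(x, x̃)` of a box `x = [l, u]` lies in `int(x)` (for a nonempty matrix set), then `det C ≠ 0`.  Proof: for a
left null vector `w` of `C` the functional `w·` takes the same value on `y ∈ x` and on its image point, which
is impossible at the vertex of `x` maximising `w·`. [cite: AlefeldMayer2000, Thm 18 (a)] -/
theorem det_ne_zero_of_krawczykSet_subset_interior {𝒜 : Set (Matrix (Fin n) (Fin n) ℝ)}
    (h𝒜 : 𝒜.Nonempty) {C : Matrix (Fin n) (Fin n) ℝ} {F : (Fin n → ℝ) → (Fin n → ℝ)}
    {xt l u : Fin n → ℝ} (hlu : l ≤ u)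
    (hK : krawczykSet 𝒜 C F xt (Icc l u) ⊆ interior (Icc l u)) : C.det ≠ 0 := by
  classical
  intro hdet
  obtain ⟨w, hw0, hwC⟩ := Matrix.exists_vecMul_eq_zero_iff.2 hdet
  obtain ⟨M, hM⟩ := h𝒜
  obtain ⟨y, hy⟩ : ∃ y : Fin n → ℝ, y = fun j => if 0 ≤ w j then u j else l j := ⟨_, rfl⟩
  have hyi : ∀ j, y j = if 0 ≤ w j then u j else l j := fun j => by rw [hy]
  have hyX : y ∈ Icc l u := by
    refine ⟨fun j => ?_, fun j => ?_⟩ <;> rw [hyi j] <;> by_cases h : 0 ≤ w j <;> simp [h, hlu j]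
  obtain ⟨p, hp⟩ : ∃ p : Fin n → ℝ, p = xt - C *ᵥ F xt - (C * M - 1) *ᵥ (y - xt) := ⟨_, rfl⟩
  have hpK : p ∈ krawczykSet 𝒜 C F xt (Icc l u) := fun i =>
    ⟨C * M, fun _ _ => ⟨M, hM, rfl⟩, y, hyX, by rw [hp]⟩
  have hpint := mem_interior_Icc_iff'.1 (hK hpK)
  have hwp : w ⬝ᵥ p = w ⬝ᵥ y := by
    have h1 : w ⬝ᵥ (C *ᵥ F xt) = 0 := by rw [dotProduct_mulVec, hwC, zero_dotProduct]
    have h2 : w ⬝ᵥ ((C * M - 1) *ᵥ (y - xt)) = -(w ⬝ᵥ (y - xt)) := by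
      rw [dotProduct_mulVec, vecMul_sub, ← vecMul_vecMul, hwC, zero_vecMul, vecMul_one, zero_sub,
        neg_dotProduct]
    rw [hp, dotProduct_sub, dotProduct_sub, h1, h2, dotProduct_sub]
    ring
  have hle : ∀ i, w i * p i ≤ w i * y i := by
    intro i
    by_cases h : 0 ≤ w i
    · rw [hyi i, if_pos h]
      exact mul_le_mul_of_nonneg_left (hpint i).2.le h
    · rw [hyi i, if_neg h]
      exact mul_le_mul_of_nonpos_left (hpint i).1.le (not_le.mp h).le
  have hlt : w ⬝ᵥ p < w ⬝ᵥ y := by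
    obtain ⟨j, hj⟩ := Function.ne_iff.1 hw0
    have hj' : w j * p j < w j * y j := by
      by_cases h : 0 ≤ w j
      · rw [hyi j, if_pos h]
        exact mul_lt_mul_of_pos_left (hpint j).2 (lt_of_le_of_ne h (Ne.symm hj))
      · rw [hyi j, if_neg h]
        exact mul_lt_mul_of_neg_left (hpint j).1 (not_le.mp h)
    show ∑ i, w i * p i < ∑ i, w i * y i
    exact Finset.sum_lt_sum (fun i _ => hle i) ⟨j, Finset.mem_univ j, hj'⟩
  exact absurd hwp (ne_of_lt hlt)

/-- `G_A(z) = 0` iff `(x(z), z_k)` is an eigenpair: `A x(z) = λ x(z)` ("`(x*, λ*)` is a solution of (85) if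
and only if `(x*, λ*)` is an eigenpair of `A` with the normalization `x*_{i₀} = ζ`").
[cite: AlefeldMayer2000, §6 eq. (85)] -/
theorem eigMap_eq_zero_iff {A : Matrix (Fin n) (Fin n) ℝ} {k : Fin n} {z : Fin n → ℝ} :
    eigMap A k z = 0 ↔ A *ᵥ eigVec k z = z k • eigVec k z :=
  sub_eq_zero

/-- Normalisation: every eigenpair `(v, μ)` of `A` with `v_k ≠ 0` is, after scaling to `v_k = 1`, a zero of
`G_A`, namely at `z := (v / v_k with slot k := μ)`. [cite: AlefeldMayer2000, §6 (remark after (85))] -/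
theorem eigMap_eq_zero_of_eigenpair {A : Matrix (Fin n) (Fin n) ℝ} {k : Fin n} {v : Fin n → ℝ} {μ : ℝ}
    (hv : v k ≠ 0) (hAv : A *ᵥ v = μ • v) :
    eigVec k (Function.update ((v k)⁻¹ • v) k μ) = (v k)⁻¹ • v ∧
      eigMap A k (Function.update ((v k)⁻¹ • v) k μ) = 0 := by
  have hx : eigVec k (Function.update ((v k)⁻¹ • v) k μ) = (v k)⁻¹ • v := by
    rw [eigVec_update]
    ext j
    by_cases hj : j = k
    · rw [hj]; simp [hv]
    · simp [eigVec_apply_of_ne hj]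
  refine ⟨hx, ?_⟩
  rw [eigMap, hx, Function.update_self, mulVec_smul, hAv, smul_comm, sub_self]

/-- `(A − λ I) v = A v − λ v`. [folklore] -/
private theorem sub_smul_one_mulVec (A : Matrix (Fin n) (Fin n) ℝ) (c : ℝ) (v : Fin n → ℝ) :
    (A - c • (1 : Matrix (Fin n) (Fin n) ℝ)) *ᵥ v = A *ᵥ v - c • v := by
  rw [sub_mulVec, Matrix.smul_mulVec, one_mulVec]

/-- Kernel description used for simplicity: with `x := x(m)`, `λ := m_k`, a vector `u` with `u_k = 0` and a
scalar `c` satisfy `J_A(m)(u with slot k := c) = (A − λ I)u − c x`. [folklore] -/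
private theorem eigJac_mulVec_update {A : Matrix (Fin n) (Fin n) ℝ} {k : Fin n} (m : Fin n → ℝ)
    {u : Fin n → ℝ} (hu : u k = 0) (c : ℝ) :
    eigJac A k m *ᵥ Function.update u k c =
      (A - m k • (1 : Matrix (Fin n) (Fin n) ℝ)) *ᵥ u - c • eigVec k m := by
  rw [eigJac_mulVec, Function.update_idem, Function.update_self, Function.update_eq_self_iff.2 hu.symm]

/-- **Krawczyk verification of a simple real eigenpair** (Rump 1983; Alefeld–Mayer 2000, Theorem 18 (a)–(f), in
the `n`-dimensional reduced form with `ζ = 1`, under the Lipschitz-matrix hypothesis of Neumaier's Theorem 5.1.8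
as used by interval implementations that enclose the FULL Jacobian range).
Let `A, C ∈ ℝⁿˣⁿ`, `k` an index, `x = [l, u]` a box of unknowns `z = (x₋ₖ, λ)` (`λ` stored in slot `k`),
`z̃ ∈ int(x)`, and `J = [J̲, J̄]` an interval matrix containing `J_A(m)` for every `m ∈ x`.  If the set-rendered
Krawczyk image `K(x, z̃) = z̃ − C G_A(z̃) − (C J − I)(x − z̃)` satisfies `K ⊆ int(x)`, then:
(a) `C` is nonsingular and every `M ∈ J` is nonsingular; (b)/(d) there is exactly one `z⋆ ∈ x` with
`A x(z⋆) = λ⋆ x(z⋆)`, `λ⋆ := z⋆ₖ` — i.e. exactly one eigenvector of `A` in the box normalised by `x_k = 1`, with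
its eigenvalue — and `z⋆ ∈ K(x, z̃)`; (c) `λ⋆` is the only real eigenvalue of `A` in `[lₖ, uₖ]`;
(e) `λ⋆` is geometrically simple (its eigenspace is `ℝ x(z⋆)`); (f) `λ⋆` is algebraically simple: the whole
generalised eigenspace `⋃ₘ ker (A − λ⋆I)^(m+1)` is `ℝ x(z⋆)`.
[cite: AlefeldMayer2000, Thm 18 (a)-(f)] [cite: Neumaier1991, Thm 5.1.8] -/
theorem krawczyk_eigenpair {A C Jl Ju : Matrix (Fin n) (Fin n) ℝ} {k : Fin n} {l u zt : Fin n → ℝ}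
    (hzt : zt ∈ interior (Icc l u))
    (hJ : ∀ m ∈ Icc l u, eigJac A k m ∈ matrixIcc Jl Ju)
    (hK : krawczykSet (matrixIcc Jl Ju) C (eigMap A k) zt (Icc l u) ⊆ interior (Icc l u)) :
    C.det ≠ 0 ∧
    (∀ M ∈ matrixIcc Jl Ju, M.det ≠ 0) ∧
    ∃ z ∈ Icc l u,
      z ∈ krawczykSet (matrixIcc Jl Ju) C (eigMap A k) zt (Icc l u) ∧
      A *ᵥ eigVec k z = z k • eigVec k z ∧
      (∀ z' ∈ Icc l u, A *ᵥ eigVec k z' = z' k • eigVec k z' → z' = z) ∧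
      (∀ μ ∈ Icc (l k) (u k), ∀ y : Fin n → ℝ, y ≠ 0 → A *ᵥ y = μ • y → μ = z k) ∧
      (∀ y : Fin n → ℝ, A *ᵥ y = z k • y → y = y k • eigVec k z) ∧
      (∀ (m : ℕ) (y : Fin n → ℝ), ((A - z k • (1 : Matrix (Fin n) (Fin n) ℝ)) ^ (m + 1)) *ᵥ y = 0 →
        y = y k • eigVec k z) := by
  classical
  have hztX : zt ∈ Icc l u := interior_subset hzt
  have hlu : l ≤ u := fun j => (hztX.1 j).trans (hztX.2 j)
  have hLS : IsLipschitzSetOn (matrixIcc Jl Ju) (eigMap A k) (Icc l u) := isLipschitzSetOn_eigMap hJ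
  have hLip := exists_lipschitzOnWith_of_isLipschitzSetOn hLS
  have hne : (krawczykSet (matrixIcc Jl Ju) C (eigMap A k) zt (Icc l u)).Nonempty :=
    ⟨zt - C *ᵥ eigMap A k zt - (C * eigJac A k zt - 1) *ᵥ (zt - zt),
      fun _ => ⟨C * eigJac A k zt, fun _ _ => ⟨eigJac A k zt, hJ zt hztX, rfl⟩, zt, hztX, rfl⟩⟩
  obtain ⟨hreg, ⟨z, ⟨hzX, hz0⟩, huniq⟩, hinK⟩ :=
    KrawczykTest_holds n (eigMap A k) (Icc l u) Jl Ju C l u zt hLip hLS subset_rfl hzt hne hK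
  have hC : C.det ≠ 0 :=
    det_ne_zero_of_krawczykSet_subset_interior ⟨eigJac A k zt, hJ zt hztX⟩ hlu hK
  -- the verified eigenpair `(x(z), z k)`
  have heig : A *ᵥ eigVec k z = z k • eigVec k z := eigMap_eq_zero_iff.1 hz0
  have heig' : (A - z k • (1 : Matrix (Fin n) (Fin n) ℝ)) *ᵥ eigVec k z = 0 := by
    rw [sub_smul_one_mulVec, heig, sub_self]
  -- kernels of the Jacobians in `J` are trivial
  have hker : ∀ m ∈ Icc l u, ∀ t : Fin n → ℝ, eigJac A k m *ᵥ t = 0 → t = 0 := fun m hm t ht =>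
    Matrix.eq_zero_of_mulVec_eq_zero (hreg _ (hJ m hm)) ht
  -- (e) geometric simplicity
  have hgeo : ∀ y : Fin n → ℝ, A *ᵥ y = z k • y → y = y k • eigVec k z := by
    intro y hy
    obtain ⟨w, hw⟩ : ∃ w : Fin n → ℝ, w = y - y k • eigVec k z := ⟨_, rfl⟩
    have hwk : w k = 0 := by rw [hw]; simp
    have hJw : eigJac A k z *ᵥ Function.update w k 0 = 0 := by
      rw [eigJac_mulVec_update z hwk, zero_smul, sub_zero, hw, mulVec_sub, mulVec_smul, heig', smul_zero,
        sub_zero, sub_smul_one_mulVec, hy, sub_self]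
    have ht := hker z hzX _ hJw
    rw [← hwk, Function.update_eq_self, hw] at ht
    exact sub_eq_zero.1 ht
  -- (f) algebraic simplicity: no Jordan chain of length two …
  have halg : ∀ y : Fin n → ℝ, (A - z k • (1 : Matrix (Fin n) (Fin n) ℝ)) *ᵥ
      ((A - z k • (1 : Matrix (Fin n) (Fin n) ℝ)) *ᵥ y) = 0 →
      (A - z k • (1 : Matrix (Fin n) (Fin n) ℝ)) *ᵥ y = 0 := by
    intro y hy
    obtain ⟨v, hv⟩ : ∃ v : Fin n → ℝ, v = (A - z k • (1 : Matrix (Fin n) (Fin n) ℝ)) *ᵥ y := ⟨_, rfl⟩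
    have hAv : A *ᵥ v = z k • v := by
      have h0 : (A - z k • (1 : Matrix (Fin n) (Fin n) ℝ)) *ᵥ v = 0 := by rw [hv]; exact hy
      rwa [sub_smul_one_mulVec, sub_eq_zero] at h0
    have hvx : v = v k • eigVec k z := hgeo v hAv
    obtain ⟨w, hw⟩ : ∃ w : Fin n → ℝ, w = y - y k • eigVec k z := ⟨_, rfl⟩
    have hwk : w k = 0 := by rw [hw]; simp
    have hJw : eigJac A k z *ᵥ Function.update w k (v k) = 0 := by
      rw [eigJac_mulVec_update z hwk, hw, mulVec_sub, mulVec_smul, heig', smul_zero, sub_zero, ← hv,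
        ← hvx, sub_self]
    have ht := hker z hzX _ hJw
    have hvk : v k = 0 := by simpa using congr_fun ht k
    rw [← hv, hvx, hvk, zero_smul]
  -- … hence every generalised eigenvector is a multiple of `x(z)`
  have hgen : ∀ (m : ℕ) (y : Fin n → ℝ),
      ((A - z k • (1 : Matrix (Fin n) (Fin n) ℝ)) ^ (m + 1)) *ᵥ y = 0 →
      (A - z k • (1 : Matrix (Fin n) (Fin n) ℝ)) *ᵥ y = 0 := by
    intro m
    induction m with
    | zero => intro y hy; simpa using hy
    | succ m ih =>
        intro y hy
        rw [pow_succ, ← mulVec_mulVec] at hy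
        exact halg y (ih _ hy)
  -- (c) `z k` is the only real eigenvalue in `[l k, u k]`
  have honly : ∀ μ ∈ Icc (l k) (u k), ∀ y : Fin n → ℝ, y ≠ 0 → A *ᵥ y = μ • y → μ = z k := by
    intro μ hμ y hy0 hy
    obtain ⟨m, hm⟩ : ∃ m : Fin n → ℝ, m = Function.update z k μ := ⟨_, rfl⟩
    have hmX : m ∈ Icc l u := by
      rw [hm]
      rw [mem_Icc] at hzX ⊢
      exact ⟨le_update_iff.2 ⟨hμ.1, fun j _ => hzX.1 j⟩, update_le_iff.2 ⟨hμ.2, fun j _ => hzX.2 j⟩⟩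
    have hmk : m k = μ := by rw [hm]; simp
    have hmx : eigVec k m = eigVec k z := by rw [hm]; simp
    obtain ⟨w, hw⟩ : ∃ w : Fin n → ℝ, w = y - y k • eigVec k z := ⟨_, rfl⟩
    have hwk : w k = 0 := by rw [hw]; simp
    have hAw : (A - μ • (1 : Matrix (Fin n) (Fin n) ℝ)) *ᵥ w = (y k * (μ - z k)) • eigVec k z := by
      rw [hw, mulVec_sub, mulVec_smul, sub_smul_one_mulVec, sub_smul_one_mulVec, hy, heig, sub_self,
        zero_sub, ← sub_smul, smul_smul, ← neg_smul]
      congr 1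
      ring
    have hJt : eigJac A k m *ᵥ Function.update w k (y k * (μ - z k)) = 0 := by
      rw [eigJac_mulVec_update m hwk, hmk, hmx, hAw, sub_self]
    have ht := hker m hmX _ hJt
    have hck : y k * (μ - z k) = 0 := by simpa using congr_fun ht k
    have hw0 : w = 0 := by
      ext j
      by_cases hj : j = k
      · rw [hj, hwk]; rfl
      · have := congr_fun ht j
        rwa [Function.update_of_ne hj] at this
    have hyc : y = y k • eigVec k z := by rw [← sub_eq_zero, ← hw, hw0]
    have hc0 : y k ≠ 0 := fun h0 => hy0 (by rw [hyc, h0, zero_smul])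
    exact (sub_eq_zero.1 ((mul_eq_zero.1 hck).resolve_left hc0))
  refine ⟨hC, hreg, z, hzX, hinK z hzX hz0, heig, fun z' hz' he => huniq z' ⟨hz', eigMap_eq_zero_iff.2 he⟩,
    honly, hgeo, fun m y hy => hgeo y ?_⟩
  have h0 := hgen m y hy
  rwa [sub_smul_one_mulVec, sub_eq_zero] at h0

/-! ## The matrix-family form (cap.spectral kind `krawczyk-eigpair`) -/

/-- Entrywise LOWER bound of the interval Jacobian `J(𝒜, x)` over the matrix box `𝒜 = [A̲, Ā]` and the box
`x = [l, u]` (it depends on `A̲` and the UPPER corner `u` only): column `k` is `−x(u)`, the diagonal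
`A̲ᵢᵢ − uₖ`, off-diagonal `A̲ᵢⱼ`. [folklore] -/
def eigJacLo (Al : Matrix (Fin n) (Fin n) ℝ) (k : Fin n) (u : Fin n → ℝ) : Matrix (Fin n) (Fin n) ℝ :=
  Matrix.of fun i j => if j = k then -eigVec k u i else Al i j - if i = j then u k else 0

/-- Entrywise UPPER bound of the interval Jacobian `J(𝒜, x)` (it depends on `Ā` and the LOWER corner `l`
only): column `k` is `−x(l)`, the diagonal `Āᵢᵢ − lₖ`, off-diagonal `Āᵢⱼ`. [folklore] -/
def eigJacHi (Au : Matrix (Fin n) (Fin n) ℝ) (k : Fin n) (l : Fin n → ℝ) : Matrix (Fin n) (Fin n) ℝ :=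
  Matrix.of fun i j => if j = k then -eigVec k l i else Au i j - if i = j then l k else 0

/-- The natural interval Jacobian contains every point Jacobian: `A ∈ [A̲, Ā]`, `m ∈ [l, u]` ⇒
`J_A(m) ∈ [J̲, J̄]` — the range-enclosure property `x ∈ [x] ⇒ f(x) ∈ f([x])` of interval evaluation, for
the interval Jacobian of (86). [cite: AlefeldMayer2000, §2 eq. (7)–(8); §6 eq. (86)] -/
theorem eigJac_mem_matrixIcc {Al Au A : Matrix (Fin n) (Fin n) ℝ} {k : Fin n} {l u m : Fin n → ℝ}
    (hA : A ∈ matrixIcc Al Au) (hm : m ∈ Icc l u) :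
    eigJac A k m ∈ matrixIcc (eigJacLo Al k u) (eigJacHi Au k l) := by
  intro i j
  have hmi : ∀ i, l i ≤ m i ∧ m i ≤ u i := fun i => ⟨hm.1 i, hm.2 i⟩
  by_cases hj : j = k
  · rw [hj]
    by_cases hi : i = k
    · rw [hi]; simp [eigJac, eigJacLo, eigJacHi]
    · simp only [eigJac, eigJacLo, eigJacHi, of_apply, if_true, eigVec_apply_of_ne hi, neg_le_neg_iff]
      exact ⟨(hmi i).2, (hmi i).1⟩
  · rcases eq_or_ne i j with rfl | hij
    · simp only [eigJac, eigJacLo, eigJacHi, of_apply, hj, if_false, if_true]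
      exact ⟨sub_le_sub (hA i i).1 (hmi k).2, sub_le_sub (hA i i).2 (hmi k).1⟩
    · simp only [eigJac, eigJacLo, eigJacHi, of_apply, hj, hij, if_false, sub_zero]
      exact hA i j

/-- SET RENDERING of the interval evaluation of the Krawczyk operator OVER A MATRIX FAMILY `𝒜`:
`K(x, z̃) = z̃ − C·G_𝒜(z̃) − (C·J − I)(x − z̃)`, evaluated row by row with, in each row, an independent choice
of the matrix `A ∈ 𝒜` entering `G_A(z̃)`, of `B ∈ C·J` and of `y ∈ x` (every interval quantity occurs once
per row, so interval evaluation = exact range of the row). [folklore] -/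
def krawczykFamSet (𝒜 J : Set (Matrix (Fin n) (Fin n) ℝ)) (C : Matrix (Fin n) (Fin n) ℝ) (k : Fin n)
    (zt : Fin n → ℝ) (X : Set (Fin n → ℝ)) : Set (Fin n → ℝ) :=
  {z | ∀ i, ∃ A ∈ 𝒜, ∃ B ∈ imulSet C J, ∃ y ∈ X,
    z i = (zt - C *ᵥ eigMap A k zt - (B - 1) *ᵥ (y - zt) : Fin n → ℝ) i}

/-- For each member `A` of the family, its own Krawczyk image is contained in the family image (inclusion
monotonicity of interval evaluation, `[x] ⊆ [y] ⇒ f([x]) ⊆ f([y])`, for the degenerate `[A, A] ⊆ 𝒜`).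
[cite: AlefeldMayer2000, §2 eq. (6)] -/
theorem krawczykSet_subset_krawczykFamSet {𝒜 J : Set (Matrix (Fin n) (Fin n) ℝ)}
    {A C : Matrix (Fin n) (Fin n) ℝ} {k : Fin n} {zt : Fin n → ℝ} {X : Set (Fin n → ℝ)} (hA : A ∈ 𝒜) :
    krawczykSet J C (eigMap A k) zt X ⊆ krawczykFamSet 𝒜 J C k zt X := by
  intro z hz i
  obtain ⟨B, hB, y, hy, h⟩ := hz i
  exact ⟨A, hA, B, hB, y, hy, h⟩

/-- **Family form** (the statement checked by `cap.spectral` kind `krawczyk-eigpair`): let `𝒜 = [A̲, Ā]` be a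
matrix box, `J = [J̲, J̄] ⊇ {J_A(m) : A ∈ 𝒜, m ∈ x}` and `K(x, z̃) ⊆ int(x)` for the family-rendered Krawczyk
image.  Then for EVERY `A ∈ 𝒜` all conclusions of `krawczyk_eigenpair` hold: `C` and every `M ∈ J` are
nonsingular, `A` has exactly one eigenvector normalised by `x_k = 1` in the box together with its eigenvalue
`λ⋆ ∈ [lₖ, uₖ]`, the pair lies in `K`, `λ⋆` is the only real eigenvalue of `A` in `[lₖ, uₖ]`, and `λ⋆` is
geometrically and algebraically simple. [cite: AlefeldMayer2000, Thm 18 (a)-(f)] [cite: Neumaier1991, Thm 5.1.8] -/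
theorem krawczyk_eigenpair_family {Al Au C Jl Ju : Matrix (Fin n) (Fin n) ℝ} {k : Fin n}
    {l u zt : Fin n → ℝ} (hzt : zt ∈ interior (Icc l u))
    (hJ : ∀ A ∈ matrixIcc Al Au, ∀ m ∈ Icc l u, eigJac A k m ∈ matrixIcc Jl Ju)
    (hK : krawczykFamSet (matrixIcc Al Au) (matrixIcc Jl Ju) C k zt (Icc l u) ⊆ interior (Icc l u)) :
    ∀ A ∈ matrixIcc Al Au,
      C.det ≠ 0 ∧
      (∀ M ∈ matrixIcc Jl Ju, M.det ≠ 0) ∧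
      ∃ z ∈ Icc l u,
        z ∈ krawczykSet (matrixIcc Jl Ju) C (eigMap A k) zt (Icc l u) ∧
        A *ᵥ eigVec k z = z k • eigVec k z ∧
        (∀ z' ∈ Icc l u, A *ᵥ eigVec k z' = z' k • eigVec k z' → z' = z) ∧
        (∀ μ ∈ Icc (l k) (u k), ∀ y : Fin n → ℝ, y ≠ 0 → A *ᵥ y = μ • y → μ = z k) ∧
        (∀ y : Fin n → ℝ, A *ᵥ y = z k • y → y = y k • eigVec k z) ∧
        (∀ (m : ℕ) (y : Fin n → ℝ), ((A - z k • (1 : Matrix (Fin n) (Fin n) ℝ)) ^ (m + 1)) *ᵥ y = 0 →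
          y = y k • eigVec k z) :=
  fun A hA => krawczyk_eigenpair hzt (hJ A hA) ((krawczykSet_subset_krawczykFamSet hA).trans hK)

/-- **Family form with the canonical interval Jacobian** `[eigJacLo A̲ k u, eigJacHi Ā k l]` (which
satisfies the containment hypothesis of `krawczyk_eigenpair_family` by `eigJac_mem_matrixIcc`):
`K ⊆ int(x)` alone gives all conclusions of Theorem 18 (a)–(f) for every `A ∈ [A̲, Ā]`.
[cite: AlefeldMayer2000, Thm 18 (a)-(f)] [cite: Neumaier1991, Thm 5.1.8] -/
theorem krawczyk_eigenpair_family' {Al Au C : Matrix (Fin n) (Fin n) ℝ} {k : Fin n}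
    {l u zt : Fin n → ℝ} (hzt : zt ∈ interior (Icc l u))
    (hK : krawczykFamSet (matrixIcc Al Au) (matrixIcc (eigJacLo Al k u) (eigJacHi Au k l)) C k zt
      (Icc l u) ⊆ interior (Icc l u)) :
    ∀ A ∈ matrixIcc Al Au,
      C.det ≠ 0 ∧
      (∀ M ∈ matrixIcc (eigJacLo Al k u) (eigJacHi Au k l), M.det ≠ 0) ∧
      ∃ z ∈ Icc l u,
        z ∈ krawczykSet (matrixIcc (eigJacLo Al k u) (eigJacHi Au k l)) C (eigMap A k) zt (Icc l u) ∧
        A *ᵥ eigVec k z = z k • eigVec k z ∧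
        (∀ z' ∈ Icc l u, A *ᵥ eigVec k z' = z' k • eigVec k z' → z' = z) ∧
        (∀ μ ∈ Icc (l k) (u k), ∀ y : Fin n → ℝ, y ≠ 0 → A *ᵥ y = μ • y → μ = z k) ∧
        (∀ y : Fin n → ℝ, A *ᵥ y = z k • y → y = y k • eigVec k z) ∧
        (∀ (m : ℕ) (y : Fin n → ℝ), ((A - z k • (1 : Matrix (Fin n) (Fin n) ℝ)) ^ (m + 1)) *ᵥ y = 0 →
          y = y k • eigVec k z) :=
  krawczyk_eigenpair_family hzt (fun _ hA _ hm => eigJac_mem_matrixIcc hA hm) hK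

end Literature.Analysis.ValidatedNumerics

end
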